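import Literature.Computability.Complexity.SymmetricColourRefinementSymmetry
import Literature.Computability.Complexity.SymmetricColourRefinementSemantics
import Literature.Combinatorics.SimpleGraph.ColourRefinementCanonical
import HarnessLib

/-!
# Symmetric threshold circuits for ordered colour refinement and the canonical form, IV:
# the canonical adjacency matrix

Conclusion of `SymmetricColourRefinement*.lean`. The rank layer `rge u i ↦ [i ≤ canonRank u]`,
`rk u i ↦ [canonRank u = i]` (two padded majority gates and a conjunction) and the output layer
`y i j ↦ CanonAdj (Gr x) T i j` are evaluated (`SymCR.val_rk`, `SymCR.val_y`), so the compiled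
circuit with output `y o.1 o.2` computes entry `o` of the CANONICAL ADJACENCY MATRIX
`SymCR.canonMatrix T x` of the input graph (`SymCR.compile_crDAG_eval`): the adjacency matrix of
`canonGraph (Gr x) T` (`SymCR.gr_canonMatrix`), which on a CR-discrete input with `m ≤ T + 1` is
isomorphic to `Gr x` (`canonGraphIso`, `ColourRefinementCanonical.lean`). Packaged:

* `SymCR.hasSymCircuit_canonMatrix` — for every `Γ`, every entry of the canonical matrix has a
  `Γ`-symmetric `tcBasis`-circuit with at most `22·(m+1)⁴·(T+1)` gates (Anderson–Dawar 2017,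
  Thm 1 for the canonisation formula of Immerman–Lander 1990, Thm 1.9.4);
* `SymCR.gr_canonMatrix_colorable_iff` — on CR-discrete inputs the canonical matrix decodes to a
  graph that is `k`-colourable iff the input graph is.

This is the symmetric half of the compilation "general circuit on the canonical form" used to
calibrate the rigid-instance benchmark of route `PneNP/SymmetryBudget`.

## References

* [AndersonDawar2016] M. Anderson, A. Dawar, *On symmetric circuits and fixed-point logics*,
  Theory Comput. Syst. 60 (2017), Thm 1, §3.
* [ImmermanLander1990] N. Immerman, E. Lander, *Describing graphs: a first-order approach to graph
  canonization* (1990), Thm 1.9.4.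
-/

namespace Literature.Computability.Complexity

open Finset Literature.Combinatorics.SimpleGraph

namespace SymCR

open Node
open scoped Classical

variable {m T : ℕ}

section Values

variable (o : Fin m × Fin m) (x : Fin m × Fin m → Bool)

/-- **The rank threshold**: `rge u i` fires iff at least `i` vertices have a smaller final
colour than `u`, i.e. `i ≤ canonRank (Gr x) T u`. [cite: AndersonDawar2016, §3 (counting by threshold gates)] -/
theorem val_rge (u : Fin m) (i : Fin (m + 1)) :
    (crDAG m T o).val x (rge u i) = true ↔ (i : ℕ) ≤ canonRank (Gr x) T u := by
  rw [GateDAG.val_eq]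
  show (GateFn.maj (m + m)).2 (fun a => GateDAG.wire x ((crDAG m T o).val x)
    (Fin.append (fun v => Sum.inr (lt (Fin.last T) v u))
      (fun k : Fin m => if (k : ℕ) + i < m then Sum.inr tt else Sum.inr ff) a)) = true ↔ _
  rw [maj_append_iff]
  have hA : (fun v => GateDAG.wire x ((crDAG m T o).val x) (Sum.inr (lt (Fin.last T) v u))) =
      fun v => decide (ocr (Gr x) T v < ocr (Gr x) T u) := by
    funext v
    rw [GateDAG.wire_inr]
    exact eq_decide_of_iff (by rw [val_lt_iff]; simp)
  have hB : (fun k : Fin m => GateDAG.wire x ((crDAG m T o).val x)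
      (if (k : ℕ) + i < m then Sum.inr tt else Sum.inr ff)) = fun k : Fin m => decide ((k : ℕ) + i < m) := by
    funext k
    split_ifs with h
    · rw [GateDAG.wire_inr, val_tt]; exact (decide_eq_true h).symm
    · rw [GateDAG.wire_inr, val_ff]; exact (decide_eq_false h).symm
  rw [hA, hB, numOnes_decide, numOnes_decide, card_filter_add_lt (Nat.lt_succ_iff.1 i.2), ← canonRank_eq]
  have h1 := canonRank_lt_card (G := Gr x) T u
  rw [Fintype.card_fin] at h1
  have h2 := i.2
  omega

/-- `nrge u i` is the negation of `rge u i`. [folklore] -/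
theorem val_nrge (u : Fin m) (i : Fin (m + 1)) :
    (crDAG m T o).val x (nrge u i) = true ↔ ¬ ((i : ℕ) ≤ canonRank (Gr x) T u) := by
  rw [GateDAG.val_eq, ← val_rge o x u i]
  show (GateFn.not.2 fun a => GateDAG.wire x ((crDAG m T o).val x) (Sum.inr (rge u i))) = true ↔ _
  rw [not_apply, GateDAG.wire_inr]
  cases (crDAG m T o).val x (rge u i) <;> simp

/-- **The rank gate**: `rk u i` fires iff the canonical rank of `u` is `i`. [cite: ImmermanLander1990, Thm 1.9.4 (canonical labelling)] -/
theorem val_rk (u i : Fin m) : (crDAG m T o).val x (rk u i) = true ↔ canonRank (Gr x) T u = i := by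
  rw [GateDAG.val_eq]
  show (GateFn.and 2).2 (fun a => GateDAG.wire x ((crDAG m T o).val x)
    (if (a : ℕ) = 0 then Sum.inr (rge u i.castSucc) else Sum.inr (nrge u i.succ))) = true ↔ _
  rw [and_two_iff]
  simp only [Fin.val_zero, ↓reduceIte, Fin.val_one, one_ne_zero, GateDAG.wire_inr, val_rge, val_nrge,
    Fin.val_castSucc, Fin.val_succ]
  omega

/-- `yt i j u v`: `u` has rank `i`, `v` has rank `j`, and they are adjacent. [folklore] -/
theorem val_yt (i j u v : Fin m) : (crDAG m T o).val x (yt i j u v) = true ↔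
    (canonRank (Gr x) T u = i ∧ canonRank (Gr x) T v = j ∧ (Gr x).Adj u v) := by
  rw [GateDAG.val_eq]
  show (GateFn.and 3).2 (fun a => GateDAG.wire x ((crDAG m T o).val x)
    (if (a : ℕ) = 0 then Sum.inr (rk u i) else
      (if (a : ℕ) = 1 then Sum.inr (rk v j) else Sum.inr (adj u v)))) = true ↔ _
  rw [and_three_iff]
  show ((crDAG m T o).val x (rk u i) = true ∧ (crDAG m T o).val x (rk v j) = true ∧
      (crDAG m T o).val x (adj u v) = true) ↔ _
  rw [val_rk, val_rk, val_adj]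

/-- **The output layer computes the canonical adjacency relation**: `y i j ↦ CanonAdj (Gr x) T i j`.
[cite: ImmermanLander1990, Thm 1.9.4 (canonical labelling)] -/
theorem val_y (i j : Fin m) : (crDAG m T o).val x (y i j) = true ↔ CanonAdj (Gr x) T i j := by
  rw [GateDAG.val_eq]
  show (GateFn.or (m * m)).2 (fun p => GateDAG.wire x ((crDAG m T o).val x)
    (Sum.inr (yt i j (finProdFinEquiv.symm p).1 (finProdFinEquiv.symm p).2))) = true ↔ _
  rw [or_fin_iff]
  simp only [GateDAG.wire_inr, val_yt]
  constructor
  · rintro ⟨p, hu, hv, hadj⟩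
    exact ⟨_, _, hu, hv, hadj⟩
  · rintro ⟨u, v, hu, hv, hadj⟩
    exact ⟨finProdFinEquiv (u, v), by simpa using hu, by simpa using hv, by simpa using hadj⟩

/-- The DAG with output `y o.1 o.2` evaluates to entry `o` of the canonical adjacency relation.
[cite: ImmermanLander1990, Thm 1.9.4 (canonical labelling)] -/
theorem evalOut_crDAG : (crDAG m T o).evalOut x = true ↔ CanonAdj (Gr x) T o.1 o.2 := by
  show GateDAG.wire x ((crDAG m T o).val x) (Sum.inr (y o.1 o.2)) = true ↔ _
  rw [GateDAG.wire_inr, val_y]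

end Values

/-! ### The canonical adjacency matrix and the packaged circuits -/

/-- The **canonical adjacency matrix** of the graph read off `x`, after `T` rounds: entry
`(i, j)` records whether the vertices of canonical ranks `i` and `j` are adjacent.
[cite: ImmermanLander1990, Thm 1.9.4 (canonical labelling)] -/
noncomputable def canonMatrix (T : ℕ) (x : Fin m × Fin m → Bool) : Fin m × Fin m → Bool :=
  fun q => decide (CanonAdj (Gr x) T q.1 q.2)

/-- **The compiled circuit computes the canonical matrix entry.** [cite: AndersonDawar2016, Thm 1 (FPC to symmetric circuits)] -/
theorem compile_crDAG_eval (o : Fin m × Fin m) (x : Fin m × Fin m → Bool) :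
    (crDAG m T o).compile.eval x = canonMatrix T x o := by
  rw [GateDAG.compile_eval]
  exact eq_decide_of_iff (evalOut_crDAG o x)

/-- The canonical matrix decodes to the canonical form `canonGraph (Gr x) T`. [folklore] -/
theorem gr_canonMatrix (T : ℕ) (x : Fin m × Fin m → Bool) : Gr (canonMatrix T x) = canonGraph (Gr x) T := by
  ext i j
  simp only [SimpleGraph.fromRel_adj, canonMatrix, canonGraph, decide_eq_true_eq]

/-- **On a CR-discrete input the canonical matrix decodes to a graph that is `k`-colourable iff
the input graph is** (for `m ≤ T + 1`). [cite: ImmermanLander1990, Thm 1.9.4 (canonical labelling)] -/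
theorem gr_canonMatrix_colorable_iff {x : Fin m × Fin m → Bool} (hx : IsCRDiscrete (Gr x))
    (hT : m ≤ T + 1) (k : ℕ) : (Gr (canonMatrix T x)).Colorable k ↔ (Gr x).Colorable k := by
  rw [gr_canonMatrix]
  exact canonGraph_colorable_iff_of_isCRDiscrete hx hT k

/-- **Symmetric circuits for the canonical matrix** (Anderson–Dawar 2017, Thm 1, for the
canonisation formula of Immerman–Lander 1990, Thm 1.9.4): for every set `Γ` of vertex
permutations and every position `o`, the entry `x ↦ canonMatrix T x o` is computed by a
`Γ`-symmetric `tcBasis`-circuit with at most `22·(m+1)⁴·(T+1)` gates.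
[cite: AndersonDawar2016, Thm 1 (FPC to symmetric circuits)] -/
theorem hasSymCircuit_canonMatrix (T : ℕ) (Γ : Set (Equiv.Perm (Fin m))) (o : Fin m × Fin m) :
    HasSymCircuit tcBasis Γ (22 * ((m + 1) ^ 4 * (T + 1))) (fun x => canonMatrix T x o) :=
  ⟨(crDAG m T o).compile, compile_crDAG_isOver o, compile_crDAG_size_le o,
    compile_crDAG_isSymmetricUnder o Γ, fun x => compile_crDAG_eval o x⟩

/-- The same, unbundled with the circuit explicit (all entries share the size bound and the
symmetry). [cite: AndersonDawar2016, Thm 1 (FPC to symmetric circuits)] -/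
theorem exists_symmetric_canonMatrix_circuits (T : ℕ) (Γ : Set (Equiv.Perm (Fin m))) :
    ∃ C : Fin m × Fin m → Circuit (Fin m × Fin m), ∀ o,
      (C o).IsOver tcBasis ∧ (C o).IsSymmetricUnder Γ ∧ (C o).size ≤ 22 * ((m + 1) ^ 4 * (T + 1)) ∧
        (C o).Computes (fun x => canonMatrix T x o) :=
  ⟨fun o => (crDAG m T o).compile, fun o => ⟨compile_crDAG_isOver o,
    compile_crDAG_isSymmetricUnder o Γ, compile_crDAG_size_le o, fun x => compile_crDAG_eval o x⟩⟩

end SymCR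

end Literature.Computability.Complexity
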